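import Summits.BirchSwinnertonDyer.BirchSwinnertonDyer.Theses.ThetaPartnerAtTwo
import Summits.BirchSwinnertonDyer.BirchSwinnertonDyer.Theorems.ThetaPartnerAtTwoSignedKatoUpToAtTwoFlatCurrencyBridge
import Summits.BirchSwinnertonDyer.Rank1Residual.Supersingular.SprungPollackConsistency
import Literature.NumberTheory.EllipticCurves.CyclotomicZpExtensionLocalGeneratorProofs
import HarnessLib

/-!
# Route `ThetaPartnerAtTwo` (TP2), crux K3 `SignedKatoDivisibilityUpToAtTwo` (item stmt-BirchSwinnertonDyer-20308),
# line `colemanrat` — file 25: **K3 FOR `X⁺` ⟸ THE K3-SHAPED DIVISIBILITY FOR `X♭`** in the `bsd-2adic` cell's spelling — the output shape of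
# that cell's `SSFlatRoad.flatUpper_two_of_flatColemanKato[_of_mu]` / `exists_pow_mul_mem_charIdeal_of_colemanSkeletonRat'` (supplied Honda
# data `(g, c)` of line `flat_uniform_two`'s clause shapes, Sprung pair, `D♭` typed at `ap := W.frobeniusTrace 2`), with a `2`-power allowance

Width seat `bsd-wall-tp2-p2x-w2` g2 (cell `bsd-wall`). HONEST FRAMING: THEOREMS ONLY — no definition, no named fact, no instance, no `sorry`;
the K3-level theorems are CONDITIONAL certificates (`proof.conditional`) on the displayed hypothesis; closes no item; BSD is NOT proved by any
of this.

## Why this file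

Files 22 / 24 reduce K3 to a length inequality (F) resp. to a Coleman–Kato package for `X♭`. The `bsd-2adic` cell's own theorems OUTPUT, for
supplied local data, exactly K3's conclusion shape ON `X♭`: «`X♭` torsion, `Char(X♭) = (g')`, `ι(g'·h) = ϖ·ι L♭`» (`flatUpper_two_of_flatColemanKato`,
with the image certificate or `μ = 0`) or «`2^m·G ∈ Char(X♭)`, `ι G = ϖ·ι L♭`» (rational skeleton). This file is the one-step bridge: ANY such
statement for the pinned ♭ duals of a Honda datum of that line's shape at `a_2 = 0` — for ALL such data, or for SOME datum of the K4 shape —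
gives K3 BY NAME, because `Char(D♭.X) = Char(D.X)` for the K4 system (file 23) / for any system with the four clauses (files 20–21), and a
Pollack pair at trace `0` is a Sprung pair (`isSprungPair_zero_iff`, `L♭ = L⁻ = kobayashiL 1 L⁺ L⁻`). No statement about HOW the ♭ divisibility is
obtained is made here (that is the `bsd-2adic` cell's road / file 24's package), so this bridge is insensitive to the Λ-linearity convention
question of packages (lead's `G4-CONVENTION-AUDIT`): it transports a divisibility, not a skeleton.

## What is proved

* `signedKatoDivisibilityUpToAtTwo_of_flatUpTo` — K3 from (FU∀): for every habitat datum, `v ∋ 2`, every `(g, c)` with the five Honda₂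
  conjuncts of `stub_allFlatData` (lift · levels · Sprung trace · dual gen₀ (a) (b)), every newform / `ϖ`, every Sprung pair `(L♯, L♭)` at `2` and
  every `D♭ : SharpFlatSelmerDualData W κ γ (closureEmb ℚ_v) (W.frobeniusTrace 2) g c .flat`: `∃ g' h m, D♭.charIdeal = (g') ∧ ι(g'·h) = C(2^m ϖ)·ι L♭`.
* `signedKatoDivisibilityUpToAtTwo_of_exists_flatUpTo` — K3 from (FU∃): per habitat datum / newform / `ϖ` / Sprung pair THERE IS a Honda system
  of the K4 shape ((L) (TR) (GEN) (GEN₀)) at some `v ∋ 2` with a lift `g` such that every pinned `D♭` (same spelling) has that property.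

References: [Kobayashi2003] Thm. 1.3 (i); [Sprung2012] Thm. 7.14, Thm. 7.16 (pp. 1504–1505); [Pollack2003] Prop. 6.18; [Sprung2017] Thm. 1.12;
[KuriharaOtsuki2006] p. 557.
-/

set_option autoImplicit false
-- the Theorems namespace of this sub repeats the summit name by design (D-0017 nested layout)
set_option linter.dupNamespace false

noncomputable section

open scoped Classical MatrixGroups ModularForm NumberField

universe u

namespace Summit.BirchSwinnertonDyer.BirchSwinnertonDyer.Theorems

namespace SignedKatoOffTwo.FlatKernel

open CongruenceSubgroup NumberField IsDedekindDomain WeierstrassCurve Field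
  Literature.NumberTheory.GaloisRepresentations
  Literature.NumberTheory.EllipticCurves Literature.NumberTheory.EllipticCurves.ModularForms
  Literature.NumberTheory.EllipticCurves.Module Literature.NumberTheory.EllipticCurves.Rank1Residual
  Literature.NumberTheory.EllipticCurves.Kobayashi2003 Literature.NumberTheory.EllipticCurves.Sprung2012
  Literature.NumberTheory.EllipticCurves.Sprung2017 ZpExtension
  Summit.BirchSwinnertonDyer.Rank1Residual.Supersingular
  Summit.BirchSwinnertonDyer.BirchSwinnertonDyer.Theses.ThetaPartnerAtTwo

/-- A finite place of `ℚ` above `2` exists. [folklore] -/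
private theorem exists_heightOneSpectrum_two_mem₃ : ∃ v : HeightOneSpectrum (𝓞 ℚ), (2 : 𝓞 ℚ) ∈ v.asIdeal := by
  have hnu : ¬ IsUnit ((2 : ℕ) : 𝓞 ℚ) := by
    intro h
    have h' := h.map Rat.ringOfIntegersEquiv
    rw [map_natCast, Int.isUnit_iff_natAbs_eq, Int.natAbs_natCast] at h'
    exact absurd h' (by norm_num)
  obtain ⟨M, hM, hle⟩ := Ideal.exists_le_maximal (Ideal.span {((2 : ℕ) : 𝓞 ℚ)})
    (by rwa [Ne, Ideal.span_singleton_eq_top])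
  have h2M : ((2 : ℕ) : 𝓞 ℚ) ∈ M := hle (Ideal.mem_span_singleton_self _)
  refine ⟨⟨M, hM.isPrime, fun hbot => ?_⟩, by exact_mod_cast h2M⟩
  rw [hbot, Ideal.mem_bot] at h2M
  exact absurd (by exact_mod_cast h2M : (2 : ℕ) = 0) (by norm_num)

/-- **K3 for `X⁺` from the K3-shaped divisibility for `X♭`, ∀ form over Honda data of the `bsd-2adic` line's shape.** Hypothesis (FU∀): for every
curve of the theta habitat, the cyclotomic datum, every `v ∋ 2`, every local datum `(g, c)` with `g` a lift, (levels), Sprung's trace relation,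
dual level-`0` generation (a) (b), every newform `f` / period ratio `ϖ`, every Sprung pair `(L♯, L♭)` at `2` and every pinned
`D♭ : SharpFlatSelmerDualData W κ γ (closureEmb ℚ_v) (W.frobeniusTrace 2) g c .flat`: `∃ g' h m`, `Char(D♭.X) = (g')`, `ι(g'·h) = C(2^m ϖ)·ι L♭` — the
output shape of `SSFlatRoad.flatUpper_two_of_flatColemanKato` (there with `m = 0`). Proof: Pollack pair = Sprung pair at trace `0`; take the K4
Honda system (file 23: it has that shape and `Char(D♭.X) = Char(D.X)`); `L♭ = kobayashiL 1 L⁺ L⁻`. [cite: Kobayashi2003, Thm. 1.3 (i)]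
[cite: Sprung2012, Thm. 7.14 and Thm. 7.16 (pp. 1504–1505)] [cite: Pollack2003, Prop. 6.18] -/
theorem signedKatoDivisibilityUpToAtTwo_of_flatUpTo
    (hFU : ∀ (W : WeierstrassCurve ℚ) [W.IsElliptic] [W.IsGloballyMinimal],
      ¬ W.HasCM → W.analyticRank = 0 → GoodSS W 2 → W.frobeniusTrace 2 = 0 →
      ∀ (κ : ZpExtension ℚ 2) (γ : Field.absoluteGaloisGroup ℚ),
        κ.IsCyclotomic → κ.IsTopGenerator γ → IsCyclotomicVariable 2 γ →
      ∀ (v : HeightOneSpectrum (𝓞 ℚ)), (2 : 𝓞 ℚ) ∈ v.asIdeal →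
      ∀ (g : Field.absoluteGaloisGroup (v.adicCompletion ℚ)) (c : ℕ → localPoints W (v.adicCompletion ℚ)),
        κ.IsTopGenerator (resGalOfEmb (closureEmb (K := ℚ) (v.adicCompletion ℚ)) g) →
        (∀ n, c n ∈ localLayerPointsOfEmb κ (closureEmb (K := ℚ) (v.adicCompletion ℚ)) W n) →
        (∀ n, 1 ≤ n → localTraceOfEmb κ (closureEmb (K := ℚ) (v.adicCompletion ℚ)) W n (n + 1)
          (c (n + 1)) = W.frobeniusTrace 2 • c n - c (n - 1)) →
        (∀ z₀ : localLayerPointsOfEmb κ (closureEmb (K := ℚ) (v.adicCompletion ℚ)) W 0 →+ ℤ_[2],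
          evalOn W (localLayerPointsOfEmb κ (closureEmb (K := ℚ) (v.adicCompletion ℚ)) W 0) z₀ (c 0) = 0 →
            z₀ = 0) →
        (∀ a : ℤ_[2],
          (∃ z₀ : localLayerPointsOfEmb κ (closureEmb (K := ℚ) (v.adicCompletion ℚ)) W 0 →+ ℤ_[2],
            evalOn W (localLayerPointsOfEmb κ (closureEmb (K := ℚ) (v.adicCompletion ℚ)) W 0) z₀ (c 0) =
              2 * a) →
          ∃ y : localLayerPointsOfEmb κ (closureEmb (K := ℚ) (v.adicCompletion ℚ)) W 0 →+ ℤ_[2],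
            evalOn W (localLayerPointsOfEmb κ (closureEmb (K := ℚ) (v.adicCompletion ℚ)) W 0) y (c 0) = a) →
      ∀ [NeZero (W.conductorNorm ℤ)] (f : CuspForm (Gamma0 (W.conductorNorm ℤ)) 2),
          IsNewformOf W f → ∀ (ϖ : ℚ), (ϖ : ℝ) * W.realPeriodRat = plusPeriod f →
        ∀ (Ls Lf : IwasawaAlgebra 2), IsSprungPair f 2 (W.frobeniusTrace 2) Ls Lf →
        ∀ (D : SharpFlatSelmerDualData W κ γ (closureEmb (K := ℚ) (v.adicCompletion ℚ))
            (W.frobeniusTrace 2) g c .flat),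
          ∃ (g' h : IwasawaAlgebra 2) (m : ℕ), D.charIdeal = Ideal.span {g'} ∧
            iwasawaToPowerSeries 2 (g' * h) =
              PowerSeries.C ((2 : ℚ_[2]) ^ m * (ϖ : ℚ_[2])) * iwasawaToPowerSeries 2 Lf) :
    SignedKatoDivisibilityUpToAtTwo := by
  unfold SignedKatoDivisibilityUpToAtTwo
  intro W _ _ hcm hr hss ha κ γ hκ hγ hcv _ f hf ϖ hϖ Lplus Lminus hPP D
  obtain ⟨-, -, hodd, heven⟩ := hPP
  have hSP : IsSprungPair f 2 (W.frobeniusTrace 2) Lplus Lminus := by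
    rw [ha]
    exact (isSprungPair_zero_iff f 2 Lplus Lminus).mpr ⟨hodd, heven⟩
  have hKL : kobayashiL 1 Lplus Lminus = Lminus := by simp [kobayashiL]
  obtain ⟨v, hv⟩ := exists_heightOneSpectrum_two_mem₃
  obtain ⟨gl, hgl⟩ := hκ.exists_isTopGenerator_resGalOfEmb_adicCompletion v (by exact_mod_cast hv)
  obtain ⟨c, hc, htrc, hg0a, hg0b, -, hdual⟩ := flatLine_sharpFlat_signed_agree_two W hss ha hκ v hv hgl
  obtain ⟨Df⟩ := nonempty_sharpFlatSelmerDualData' W κ (closureEmb (K := ℚ) (v.adicCompletion ℚ))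
    (W.frobeniusTrace 2) gl c Chroma.flat γ
  obtain ⟨-, -, hchar, -⟩ := hdual D Df
  obtain ⟨g', h, m, hg', hgh⟩ :=
    hFU W hcm hr hss ha κ γ hκ hγ hcv v hv gl c hgl hc htrc hg0a hg0b f hf ϖ hϖ Lplus Lminus hSP Df
  exact ⟨g', h, m, hchar ▸ hg', by rw [hKL]; exact hgh⟩

/-- **K3 for `X⁺` from the K3-shaped divisibility for `X♭`, ∃ form**: per habitat datum, newform, period ratio and Sprung pair THERE IS a plus
Honda system of the K4 shape ((L) (TR) (GEN) (GEN₀)) at some `v ∋ 2` with a lift `g` such that every pinned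
`D♭ : SharpFlatSelmerDualData W κ γ (closureEmb ℚ_v) (W.frobeniusTrace 2) g d .flat` has `∃ g' h m`, `Char(D♭.X) = (g')`, `ι(g'·h) = C(2^m ϖ)·ι L♭`.
For ANY such system `Sel⁺ = Sel♭(g, d)` (file 20), so `Char(D♭.X) = Char(D.X)` (transported along `a_2(W) = 0`).
[cite: Kobayashi2003, Thm. 1.3 (i)] [cite: Sprung2012, Thm. 2.2 (2′), Thm. 7.14, Thm. 7.16] -/
theorem signedKatoDivisibilityUpToAtTwo_of_exists_flatUpTo
    (hFU : ∀ (W : WeierstrassCurve ℚ) [W.IsElliptic] [W.IsGloballyMinimal],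
      ¬ W.HasCM → W.analyticRank = 0 → GoodSS W 2 → W.frobeniusTrace 2 = 0 →
      ∀ (κ : ZpExtension ℚ 2) (γ : Field.absoluteGaloisGroup ℚ),
        κ.IsCyclotomic → κ.IsTopGenerator γ → IsCyclotomicVariable 2 γ →
      ∀ [NeZero (W.conductorNorm ℤ)] (f : CuspForm (Gamma0 (W.conductorNorm ℤ)) 2),
          IsNewformOf W f → ∀ (ϖ : ℚ), (ϖ : ℝ) * W.realPeriodRat = plusPeriod f →
        ∀ (Ls Lf : IwasawaAlgebra 2), IsSprungPair f 2 (W.frobeniusTrace 2) Ls Lf →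
        ∃ (v : HeightOneSpectrum (𝓞 ℚ)) (_ : (2 : 𝓞 ℚ) ∈ v.asIdeal)
          (g : Field.absoluteGaloisGroup (v.adicCompletion ℚ)) (d : ℕ → localPoints W (v.adicCompletion ℚ)),
          κ.IsTopGenerator (resGalOfEmb (closureEmb (K := ℚ) (v.adicCompletion ℚ)) g) ∧
          (∀ m, d m ∈ localLayerPointsOfEmb κ (closureEmb (K := ℚ) (v.adicCompletion ℚ)) W m) ∧
          (∀ m, localTraceOfEmb κ (closureEmb (K := ℚ) (v.adicCompletion ℚ)) W (m + 1) (m + 2) (d (m + 2)) = -d m) ∧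
          (∀ m : ℕ, 1 ≤ m → ∀ P ∈ localLayerPointsOfEmb κ (closureEmb (K := ℚ) (v.adicCompletion ℚ)) W m,
            ∃ B ∈ AddSubgroup.closure (Set.range fun σ : Field.absoluteGaloisGroup (v.adicCompletion ℚ) ↦ σ • d m),
              ∃ P' ∈ localLayerPointsOfEmb κ (closureEmb (K := ℚ) (v.adicCompletion ℚ)) W (m - 1),
              ∃ R ∈ localLayerPointsOfEmb κ (closureEmb (K := ℚ) (v.adicCompletion ℚ)) W m, P = B + P' + 2 • R) ∧
          (∀ P ∈ localLayerPointsOfEmb κ (closureEmb (K := ℚ) (v.adicCompletion ℚ)) W 0,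
            ∃ a : ℤ, ∃ R ∈ localLayerPointsOfEmb κ (closureEmb (K := ℚ) (v.adicCompletion ℚ)) W 0, P = a • d 0 + 2 • R) ∧
          ∀ (D : SharpFlatSelmerDualData W κ γ (closureEmb (K := ℚ) (v.adicCompletion ℚ))
              (W.frobeniusTrace 2) g d .flat),
            ∃ (g' h : IwasawaAlgebra 2) (m : ℕ), D.charIdeal = Ideal.span {g'} ∧
              iwasawaToPowerSeries 2 (g' * h) =
                PowerSeries.C ((2 : ℚ_[2]) ^ m * (ϖ : ℚ_[2])) * iwasawaToPowerSeries 2 Lf) :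
    SignedKatoDivisibilityUpToAtTwo := by
  unfold SignedKatoDivisibilityUpToAtTwo
  intro W _ _ hcm hr hss ha κ γ hκ hγ hcv _ f hf ϖ hϖ Lplus Lminus hPP D
  obtain ⟨-, -, hodd, heven⟩ := hPP
  have hSP : IsSprungPair f 2 (W.frobeniusTrace 2) Lplus Lminus := by
    rw [ha]
    exact (isSprungPair_zero_iff f 2 Lplus Lminus).mpr ⟨hodd, heven⟩
  have hKL : kobayashiL 1 Lplus Lminus = Lminus := by simp [kobayashiL]
  obtain ⟨v, hv, gl, d, hgl, hd, htr, hgen, hgen0, hup⟩ :=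
    hFU W hcm hr hss ha κ γ hκ hγ hcv f hf ϖ hϖ Lplus Lminus hSP
  have heq0 := signedSelmerInfty_eq_sharpFlatSelmerInfty_flat_two W hss hκ v hv hgl hd htr hgen hgen0
  have key : ∀ (ap : ℤ), ap = 0 →
      ∀ (Df : SharpFlatSelmerDualData W κ γ (closureEmb (K := ℚ) (v.adicCompletion ℚ)) ap gl d .flat),
        Df.charIdeal = D.charIdeal := by
    rintro ap rfl Df
    exact charIdeal_sharpFlat_eq_charIdeal_signed W κ _ gl d heq0 Df D
  obtain ⟨Df⟩ := nonempty_sharpFlatSelmerDualData' W κ (closureEmb (K := ℚ) (v.adicCompletion ℚ))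
    (W.frobeniusTrace 2) gl d Chroma.flat γ
  obtain ⟨g', h, m, hg', hgh⟩ := hup Df
  exact ⟨g', h, m, (key _ ha Df) ▸ hg', by rw [hKL]; exact hgh⟩

end SignedKatoOffTwo.FlatKernel

end Summit.BirchSwinnertonDyer.BirchSwinnertonDyer.Theorems

end
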